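import Summits.NavierStokesRegularity.NavierStokesRegularity.Theses.AxisymmetricExtremality
import Literature.Analysis.FluidPDE.Seregin2020SwirlMoserCutoffs
import Literature.Analysis.FluidPDE.SpaceTimeAxisIntegrable
import Literature.Analysis.FluidPDE.SqIntegralBalance
import HarnessLib

/-!
# Seregin 2020, Lemma 2.2 (after Nazarov–Uraltseva 2012): measure-theoretic tools for the
# passage of the energy inequality through the regular part of the axis

Helper toward the stub `stub_seregin2020TypeII` of the crux `AxisymmetricKatoGlobal` (= the named
fact `Literature.Analysis.FluidPDE.Seregin2020_axisymmetricSingularPoint_typeII`, G. Seregin,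
Anal. Math. Phys. 10 (2020) Paper 46 = arXiv:2006.04140, Thm 2.1; remaining ingredient:
Lemma 2.2 = Nazarov–Uraltseva's propagation of a lower bound from the axis). The energy
inequality of the sibling `…Lemma22EnergyInequality` is stated for cut-offs supported OFF the
axis; the sibling `…Lemma22AcrossAxis` passes it to cut-offs meeting the regular part of the
axis by inserting the axis cut-off `φ_ε` of `Seregin2020.axisCutoff_props` and letting `ε → 0`.
This file collects the generic tools of that passage, for the space–time measure
`vol|(t₁,t] ⊗ vol` of the tree's `integrable_prod_of_le_mul_one_add_inv_cylRadius`: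

* `aestronglyMeasurable_restrict_prod_of_continuousOn_offAxis`, `…_of_eq_zero` — joint
  measurability from continuity off the (Lebesgue-null) axis;
* `integrable_prod_of_continuousOn_of_eq_zero`, `integrable_prod_driftTerm`,
  `integrable_prod_axisDriftTerm` — integrability of the slice integrands: continuous ones,
  the drift term `H(Φ)⟪U, ∇Θ²⟫` for `U ∈ L³` continuous off the axis, and the axis-drift term
  `(2/ϱ)H(Φ)∂_ϱΘ²` (`1/ϱ ∈ L¹_loc`);
* `exists_forall_cylRadius_le_abs_lt` — a continuous function on a compact set which is small on
  its axis points is small on its points near the axis (Cantor's intersection theorem);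
* `prod_volume_tube_le` — the tube `{ϱ ≤ ε} ∩ K`, `K ⊆ B̄(0,R)`, has `vol|(t₁,t] ⊗ vol`-measure
  `≤ (t-t₁)·8ε²R`;
* `axisCutoff_sq_props`, `gradient_cutoffProduct_sq`, `fderiv_cutoffProduct_sq_apply`,
  `tsupport_cutoffProduct_subset` — calculus of the squared axis cut-off `φ_ε²` and of the
  product cut-off `(Θφ_ε)²`.

## References

* G. Seregin, Anal. Math. Phys. 10 (2020), Paper 46 = arXiv:2006.04140, Lemma 2.2 (arXiv p. 8).
  [Seregin2020]
* A. I. Nazarov, N. N. Uraltseva, St. Petersburg Math. J. 23 (2012) 93–115 = arXiv:1011.1888,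
  §3 (3.2), (3.9), Remark 9; §4 Lemma 4.2, (4.3). [NazarovUraltseva2012]
-/

-- the problem directory repeats the summit name (D-0017); core's `dupNamespace` linter fires
set_option linter.dupNamespace false

noncomputable section

open MeasureTheory Set Function Filter Topology TopologicalSpace Metric WithLp intervalIntegral
open scoped NNReal ENNReal InnerProductSpace RealInnerProductSpace

namespace Summit.NavierStokesRegularity.NavierStokesRegularity.Theorems.AxisymmetricKatoGlobal.EulerScaling

open Literature.Analysis.FluidPDE Literature.Analysis.FluidPDE.Seregin2020

/-! ### The space–time measure `vol|(t₁,t] ⊗ vol` -/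

/-- `vol|(t₁,t] ⊗ vol` is Lebesgue measure restricted to `(t₁,t] × ℝ³`. [folklore] -/
theorem restrict_Ioc_prod_volume_eq (t₁ t : ℝ) :
    ((volume.restrict (Ioc t₁ t)).prod (volume : Measure (EuclideanSpace ℝ (Fin 3)))) =
      (volume : Measure (ℝ × EuclideanSpace ℝ (Fin 3))).restrict (Ioc t₁ t ×ˢ univ) := by
  rw [show (volume : Measure (ℝ × EuclideanSpace ℝ (Fin 3))) = (volume : Measure ℝ).prod volume from rfl,
    ← Measure.prod_restrict, Measure.restrict_univ]

/-- `vol|(t₁,t] ⊗ vol`-a.e. point has its time in `(t₁, t]`. [folklore] -/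
theorem ae_fst_mem_Ioc (t₁ t : ℝ) :
    ∀ᵐ z ∂((volume.restrict (Ioc t₁ t)).prod (volume : Measure (EuclideanSpace ℝ (Fin 3)))), z.1 ∈ Ioc t₁ t := by
  rw [restrict_Ioc_prod_volume_eq]
  filter_upwards [ae_restrict_mem (measurableSet_Ioc.prod MeasurableSet.univ)] with z hz using hz.1

/-- `vol|(t₁,t] ⊗ vol`-a.e. point is off the axis. [folklore] -/
theorem ae_prod_cylRadius_ne_zero (t₁ t : ℝ) :
    ∀ᵐ z ∂((volume.restrict (Ioc t₁ t)).prod (volume : Measure (EuclideanSpace ℝ (Fin 3)))), cylRadius z.2 ≠ 0 := by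
  have h0 : ((volume.restrict (Ioc t₁ t)).prod (volume : Measure (EuclideanSpace ℝ (Fin 3))))
      (univ ×ˢ {x : EuclideanSpace ℝ (Fin 3) | cylRadius x = 0}) = 0 := by
    rw [Measure.prod_prod, volume_setOf_cylRadius_eq_zero, mul_zero]
  filter_upwards [measure_eq_zero_iff_ae_notMem.1 h0] with z hz
  exact fun h => hz ⟨mem_univ _, h⟩

/-! ### Measurability and integrability from continuity off the axis -/

/-- **Joint measurability from continuity off the axis.** If `F` is continuous on
`I × (A ∖ {ϱ = 0})` (`I`, `A` measurable), then `F` is a.e.-strongly measurable for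
`vol|_{I × A}`: the axis is Lebesgue-null in `ℝ³`. [folklore] -/
theorem aestronglyMeasurable_restrict_prod_of_continuousOn_offAxis {β : Type*} [TopologicalSpace β]
    [PseudoMetrizableSpace β] {I : Set ℝ} (hI : MeasurableSet I)
    {A : Set (EuclideanSpace ℝ (Fin 3))} (hA : MeasurableSet A)
    {F : ℝ × EuclideanSpace ℝ (Fin 3) → β} (hF : ContinuousOn F (I ×ˢ (A ∩ {x | cylRadius x ≠ 0}))) :
    AEStronglyMeasurable F ((volume : Measure (ℝ × EuclideanSpace ℝ (Fin 3))).restrict (I ×ˢ A)) := by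
  -- adapted from `aemeasurable_prod_restrict_of_continuousOn_offAxis` (sibling module `…MoserA`)
  set B : Set (ℝ × EuclideanSpace ℝ (Fin 3)) := I ×ˢ (A ∩ {x | cylRadius x ≠ 0}) with hB
  have hopen : IsOpen {x : EuclideanSpace ℝ (Fin 3) | cylRadius x ≠ 0} :=
    isOpen_ne_fun continuous_cylRadius continuous_const
  have hBm : MeasurableSet B := hI.prod (hA.inter hopen.measurableSet)
  have hμ : (volume : Measure (ℝ × EuclideanSpace ℝ (Fin 3))).restrict (I ×ˢ A) = volume.restrict B := by
    refine Measure.restrict_congr_set ?_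
    have hdiff : (I ×ˢ A) \ B ⊆ univ ×ˢ {x : EuclideanSpace ℝ (Fin 3) | cylRadius x = 0} := by
      rintro p ⟨⟨h1, h2⟩, h3⟩
      refine ⟨mem_univ _, ?_⟩
      by_contra h4
      exact h3 ⟨h1, h2, h4⟩
    have hnull : (volume : Measure (ℝ × EuclideanSpace ℝ (Fin 3))) ((I ×ˢ A) \ B) = 0 := by
      refine measure_mono_null hdiff ?_
      rw [show (volume : Measure (ℝ × EuclideanSpace ℝ (Fin 3))) = (volume : Measure ℝ).prod volume from rfl,
        Measure.prod_prod, volume_setOf_cylRadius_eq_zero, mul_zero]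
    have hsub : B ⊆ I ×ˢ A := prod_mono Subset.rfl inter_subset_left
    exact ae_eq_set.2 ⟨hnull, measure_mono_null (fun p hp => absurd (hsub hp.1) hp.2) measure_empty⟩
  rw [hμ]
  exact hF.aestronglyMeasurable hBm

/-- **Joint measurability for `vol|(t₁,t] ⊗ vol` of functions continuous off the axis on a slab
and vanishing off a compact.** If `g` is continuous on `]lo,hi[ × (W ∖ {ϱ = 0})` (`W` open),
vanishes at the points `(s, x)` with `x ∉ K` for a compact `K ⊆ W`, and `lo < t₁`, `t < hi`, then
`g` is a.e.-strongly measurable for `vol|(t₁,t] ⊗ vol`. [folklore] -/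
theorem aestronglyMeasurable_prod_of_continuousOn_offAxis_of_eq_zero {β : Type*} [TopologicalSpace β]
    [PseudoMetrizableSpace β] [Zero β] {W K : Set (EuclideanSpace ℝ (Fin 3))} (hW : IsOpen W)
    (hK : IsCompact K) (hKW : K ⊆ W) {lo hi t₁ t : ℝ} (h1 : lo < t₁) (ht : t < hi)
    {g : ℝ × EuclideanSpace ℝ (Fin 3) → β}
    (hg : ContinuousOn g (Ioo lo hi ×ˢ (W ∩ {x | cylRadius x ≠ 0})))
    (h0 : ∀ z : ℝ × EuclideanSpace ℝ (Fin 3), z.2 ∉ K → g z = 0) :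
    AEStronglyMeasurable g ((volume.restrict (Ioc t₁ t)).prod volume) := by
  have hcont : ContinuousOn g (Ioc t₁ t ×ˢ (univ ∩ {x | cylRadius x ≠ 0})) := by
    rintro p ⟨hp1, -, hpρ⟩
    have hp1' : p.1 ∈ Ioo lo hi := ⟨h1.trans hp1.1, hp1.2.trans_lt ht⟩
    by_cases hx : p.2 ∈ W
    · have hpS : p ∈ Ioo lo hi ×ˢ (W ∩ {x | cylRadius x ≠ 0}) := ⟨hp1', hx, hpρ⟩
      have hmem : Ioo lo hi ×ˢ (W ∩ {x | cylRadius x ≠ 0}) ∈ 𝓝 p :=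
        (isOpen_Ioo.prod (hW.inter (isOpen_ne_fun continuous_cylRadius continuous_const))).mem_nhds hpS
      exact ((hg p hpS).continuousAt hmem).continuousWithinAt
    · have hxK : p.2 ∉ K := fun h => hx (hKW h)
      have hev : g =ᶠ[𝓝 p] fun _ => 0 := by
        filter_upwards [(isOpen_univ.prod hK.isClosed.isOpen_compl).mem_nhds ⟨mem_univ _, hxK⟩] with q hq
        exact h0 q hq.2
      exact (continuousAt_const.congr hev.symm).continuousWithinAt
  have h := aestronglyMeasurable_restrict_prod_of_continuousOn_offAxis measurableSet_Ioc MeasurableSet.univ hcont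
  rwa [restrict_Ioc_prod_volume_eq]

/-- **Integrability of continuous slice integrands.** A function continuous on `]lo,hi[ × W`
vanishing at the points `(s, x)` with `x ∉ K`, `K ⊆ W` compact, is integrable for
`vol|(t₁,t] ⊗ vol` whenever `lo < t₁`, `t < hi`. [folklore] -/
theorem integrable_prod_of_continuousOn_of_eq_zero {W K : Set (EuclideanSpace ℝ (Fin 3))}
    (hK : IsCompact K) (hKW : K ⊆ W) {lo hi t₁ t : ℝ} (h1 : lo < t₁) (ht : t < hi)
    {g : ℝ × EuclideanSpace ℝ (Fin 3) → ℝ} (hg : ContinuousOn g (Ioo lo hi ×ˢ W))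
    (h0 : ∀ z : ℝ × EuclideanSpace ℝ (Fin 3), z.2 ∉ K → g z = 0) :
    Integrable g ((volume.restrict (Ioc t₁ t)).prod volume) := by
  rw [restrict_Ioc_prod_volume_eq]
  have hsub : Icc t₁ t ×ˢ K ⊆ Ioo lo hi ×ˢ W :=
    prod_mono (fun r hr => ⟨h1.trans_le hr.1, hr.2.trans_lt ht⟩) hKW
  have hI : IntegrableOn g (Icc t₁ t ×ˢ K) volume :=
    (hg.mono hsub).integrableOn_compact (isCompact_Icc.prod hK)
  refine (hI.mono_set (prod_mono Ioc_subset_Icc_self Subset.rfl)).of_forall_sdiff_eq_zero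
    (measurableSet_Ioc.prod MeasurableSet.univ) ?_
  rintro z ⟨⟨hz1, -⟩, hz2⟩
  exact h0 z fun h => hz2 ⟨hz1, h⟩

/-- **Integrability of the drift term `c⟪U, v⟫`** for a drift `U` continuous off the axis on the
slab `]lo,hi[ × O` with `∬_{slab} |U|³ < ∞`, and factors `c`, `v` continuous on the slab with `v`
vanishing off a compact `K ⊆ O` (`|U| ≤ 1 + |U|³`). [folklore] -/
theorem integrable_prod_driftTerm {O K : Set (EuclideanSpace ℝ (Fin 3))} (hO : IsOpen O) (hK : IsCompact K)
    (hKO : K ⊆ O) {lo hi t₁ t : ℝ} (h1 : lo < t₁) (ht : t < hi)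
    {U : ℝ → EuclideanSpace ℝ (Fin 3) → EuclideanSpace ℝ (Fin 3)}
    (hUc : ContinuousOn (uncurry U) (Ioo lo hi ×ˢ (O ∩ {x | cylRadius x ≠ 0})))
    (hU3 : ∫⁻ z in Ioo lo hi ×ˢ O, ‖U z.1 z.2‖ₑ ^ (3 : ℕ) < ⊤)
    {c : ℝ × EuclideanSpace ℝ (Fin 3) → ℝ} {v : ℝ × EuclideanSpace ℝ (Fin 3) → EuclideanSpace ℝ (Fin 3)}
    (hc : ContinuousOn c (Ioo lo hi ×ˢ O)) (hv : ContinuousOn v (Ioo lo hi ×ˢ O))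
    (h0 : ∀ z : ℝ × EuclideanSpace ℝ (Fin 3), z.2 ∉ K → v z = 0) :
    Integrable (fun z => c z * ⟪U z.1 z.2, v z⟫) ((volume.restrict (Ioc t₁ t)).prod volume) := by
  set μ : Measure (ℝ × EuclideanSpace ℝ (Fin 3)) := (volume.restrict (Ioc t₁ t)).prod volume with hμ
  have hIoc : Ioc t₁ t ⊆ Ioo lo hi := fun r hr => ⟨h1.trans hr.1, hr.2.trans_lt ht⟩
  have hsub' : Ioo lo hi ×ˢ (O ∩ {x : EuclideanSpace ℝ (Fin 3) | cylRadius x ≠ 0}) ⊆ Ioo lo hi ×ˢ O :=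
    prod_mono Subset.rfl inter_subset_left
  -- measurability
  have hm : AEStronglyMeasurable (fun z => c z * ⟪U z.1 z.2, v z⟫) μ := by
    refine aestronglyMeasurable_prod_of_continuousOn_offAxis_of_eq_zero hO hK hKO h1 ht ?_
      (fun z hz => by simp [h0 z hz])
    exact (hc.mono hsub').mul (hUc.inner (hv.mono hsub'))
  -- a bound of `‖c‖ ‖v‖` on `[t₁, t] × K`
  have hsubK : Icc t₁ t ×ˢ K ⊆ Ioo lo hi ×ˢ O := prod_mono (fun r hr => ⟨h1.trans_le hr.1, hr.2.trans_lt ht⟩) hKO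
  obtain ⟨C, hC⟩ := (isCompact_Icc.prod hK).exists_bound_of_continuousOn (f := fun z => ‖c z‖ * ‖v z‖)
    ((hc.norm.mul hv.norm).mono hsubK)
  -- the dominating function `|C| (1 + |U|³) 1_K`
  have hKm : MeasurableSet (univ ×ˢ K : Set (ℝ × EuclideanSpace ℝ (Fin 3))) := MeasurableSet.univ.prod hK.measurableSet
  have hrestr : μ.restrict (univ ×ˢ K) = volume.restrict (Ioc t₁ t ×ˢ K) := by
    rw [hμ, restrict_Ioc_prod_volume_eq, Measure.restrict_restrict hKm, prod_inter_prod, univ_inter, inter_univ]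
  have hfin : volume (Ioc t₁ t ×ˢ K) ≠ ∞ := by
    rw [show (volume : Measure (ℝ × EuclideanSpace ℝ (Fin 3))) = (volume : Measure ℝ).prod volume from rfl,
      Measure.prod_prod]
    exact ENNReal.mul_ne_top measure_Ioc_lt_top.ne hK.measure_lt_top.ne
  have hU3' : Integrable (fun z : ℝ × EuclideanSpace ℝ (Fin 3) => ‖U z.1 z.2‖ ^ 3) (volume.restrict (Ioc t₁ t ×ˢ K)) := by
    refine ⟨?_, ?_⟩
    · have hUm := aestronglyMeasurable_restrict_prod_of_continuousOn_offAxis measurableSet_Ioc hK.measurableSet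
        (F := fun z : ℝ × EuclideanSpace ℝ (Fin 3) => U z.1 z.2)
        (hUc.mono (prod_mono hIoc (inter_subset_inter_left _ hKO)))
      exact (continuous_norm.pow 3).comp_aestronglyMeasurable hUm
    · have hle : ∫⁻ z in Ioc t₁ t ×ˢ K, ‖(‖U z.1 z.2‖ ^ 3 : ℝ)‖ₑ ≤ ∫⁻ z in Ioo lo hi ×ˢ O, ‖U z.1 z.2‖ₑ ^ (3 : ℕ) := by
        refine (lintegral_mono_set (prod_mono hIoc hKO)).trans_eq' ?_
        refine lintegral_congr fun z => ?_
        rw [Real.enorm_eq_ofReal (pow_nonneg (norm_nonneg _) 3), ENNReal.ofReal_pow (norm_nonneg _),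
          ofReal_norm]
      exact hle.trans_lt hU3
  have hD : Integrable (fun z : ℝ × EuclideanSpace ℝ (Fin 3) =>
      (univ ×ˢ K : Set (ℝ × EuclideanSpace ℝ (Fin 3))).indicator (fun z => |C| * (1 + ‖U z.1 z.2‖ ^ 3)) z) μ := by
    refine IntegrableOn.integrable_indicator ?_ hKm
    rw [IntegrableOn, hrestr]
    exact ((integrableOn_const hfin).add hU3').const_mul |C|
  refine hD.mono' hm ?_
  filter_upwards [ae_fst_mem_Ioc t₁ t] with z hz
  by_cases hzK : z.2 ∈ K
  · rw [indicator_of_mem (show z ∈ univ ×ˢ K from ⟨mem_univ _, hzK⟩)]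
    have hcv : ‖c z‖ * ‖v z‖ ≤ |C| := by
      have h := hC z ⟨Ioc_subset_Icc_self hz, hzK⟩
      rw [Real.norm_of_nonneg (mul_nonneg (norm_nonneg _) (norm_nonneg _))] at h
      exact h.trans (le_abs_self C)
    have hU1 : ‖U z.1 z.2‖ ≤ 1 + ‖U z.1 z.2‖ ^ 3 := by
      rcases le_or_gt ‖U z.1 z.2‖ 1 with h | h
      · linarith [pow_nonneg (norm_nonneg (U z.1 z.2)) 3]
      · have hu : 0 ≤ ‖U z.1 z.2‖ * (‖U z.1 z.2‖ - 1) * (‖U z.1 z.2‖ + 1) :=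
          mul_nonneg (mul_nonneg (norm_nonneg _) (by linarith)) (by linarith [norm_nonneg (U z.1 z.2)])
        nlinarith [hu]
    calc ‖c z * ⟪U z.1 z.2, v z⟫‖ = ‖c z‖ * |⟪U z.1 z.2, v z⟫| := by simp only [norm_mul, Real.norm_eq_abs]
      _ ≤ ‖c z‖ * (‖U z.1 z.2‖ * ‖v z‖) := mul_le_mul_of_nonneg_left (abs_real_inner_le_norm _ _) (norm_nonneg _)
      _ = ‖c z‖ * ‖v z‖ * ‖U z.1 z.2‖ := by ring
      _ ≤ |C| * (1 + ‖U z.1 z.2‖ ^ 3) := mul_le_mul hcv hU1 (norm_nonneg _) (abs_nonneg _)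
  · rw [indicator_of_notMem (show z ∉ univ ×ˢ K from fun h => hzK h.2), h0 z hzK, inner_zero_right, mul_zero,
      norm_zero]

/-- **Integrability of the axis-drift term `(2/ϱ) w`** for `w` continuous off the axis on the slab,
vanishing off a compact `K ⊆ O` and bounded on `[t₁,t] × K` (`1/ϱ ∈ L¹_loc(ℝ³)`, the tree's
`integrable_prod_of_le_mul_one_add_inv_cylRadius`). [folklore] -/
theorem integrable_prod_axisDriftTerm {O K : Set (EuclideanSpace ℝ (Fin 3))} (hO : IsOpen O)
    (hK : IsCompact K) (hKO : K ⊆ O) {lo hi t₁ t : ℝ} (h1 : lo < t₁) (ht : t < hi)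
    {w : ℝ × EuclideanSpace ℝ (Fin 3) → ℝ} (hw : ContinuousOn w (Ioo lo hi ×ˢ (O ∩ {x | cylRadius x ≠ 0})))
    (h0 : ∀ z : ℝ × EuclideanSpace ℝ (Fin 3), z.2 ∉ K → w z = 0) {C : ℝ}
    (hC : ∀ z ∈ Icc t₁ t ×ˢ K, |w z| ≤ C) :
    Integrable (fun z => 2 / cylRadius z.2 * w z) ((volume.restrict (Ioc t₁ t)).prod volume) := by
  refine integrable_prod_of_le_mul_one_add_inv_cylRadius hK ?_ (fun s x hx => by simp [h0 (s, x) hx])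
    (C := 2 * |C|) ?_
  · refine aestronglyMeasurable_prod_of_continuousOn_offAxis_of_eq_zero hO hK hKO h1 ht ?_
      (fun z hz => by simp [h0 z hz])
    have cinv : ContinuousOn (fun z : ℝ × EuclideanSpace ℝ (Fin 3) => 2 / cylRadius z.2)
        (Ioo lo hi ×ˢ (O ∩ {x | cylRadius x ≠ 0})) :=
      continuousOn_const.div (continuous_cylRadius.comp continuous_snd).continuousOn fun z hz => hz.2.2
    exact cinv.mul hw
  · intro s hs x hx
    have hρ0 : 0 ≤ cylRadius x := cylRadius_nonneg x
    have hwb : |w (s, x)| ≤ |C| := (hC (s, x) ⟨Ioc_subset_Icc_self hs, hx⟩).trans (le_abs_self C)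
    rw [abs_mul, abs_div, abs_of_nonneg hρ0, abs_two]
    calc 2 / cylRadius x * |w (s, x)| ≤ 2 / cylRadius x * |C| :=
          mul_le_mul_of_nonneg_left hwb (div_nonneg zero_le_two hρ0)
      _ = 2 * |C| * (cylRadius x)⁻¹ := by ring
      _ ≤ 2 * |C| * (1 + (cylRadius x)⁻¹) := by nlinarith [abs_nonneg C, inv_nonneg.2 hρ0]

/-! ### Uniform smallness near the axis points of a compact set -/

/-- **A continuous function on a compact set, small at its axis points, is small near the
axis** (Cantor's intersection theorem for the compact sets `{|g| ≥ δ} ∩ {ϱ ≤ 1/(i+1)}`). This is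
how the continuity of `Φ` up to the regular part of the axis, where `Φ ≥ k` and hence
`H(Φ) = 0`, enters the removal of the axis cut-off. [folklore] -/
theorem exists_forall_cylRadius_le_abs_lt {K' : Set (ℝ × EuclideanSpace ℝ (Fin 3))} (hK' : IsCompact K')
    {g : ℝ × EuclideanSpace ℝ (Fin 3) → ℝ} (hg : ContinuousOn g K') {δ : ℝ}
    (hδ : ∀ z ∈ K', cylRadius z.2 = 0 → |g z| < δ) :
    ∃ ε : ℝ, 0 < ε ∧ ∀ z ∈ K', cylRadius z.2 ≤ ε → |g z| < δ := by
  set s : Set (ℝ × EuclideanSpace ℝ (Fin 3)) := K' ∩ (fun z => ‖g z‖) ⁻¹' Ici δ with hs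
  have hcl : IsClosed s := hg.norm.preimage_isClosed_of_isClosed hK'.isClosed isClosed_Ici
  have hsc : IsCompact s := hK'.of_isClosed_subset hcl inter_subset_left
  set T : ℕ → Set (ℝ × EuclideanSpace ℝ (Fin 3)) := fun i => {z | cylRadius z.2 ≤ 1 / ((i : ℝ) + 1)} with hT
  have hTc : ∀ i, IsClosed (T i) := fun i =>
    isClosed_le (continuous_cylRadius.comp continuous_snd) continuous_const
  have hdir : Directed (· ⊇ ·) T := by
    refine directed_of_isDirected_le fun i j hij => ?_
    intro z hz
    have hle : 1 / ((j : ℝ) + 1) ≤ 1 / ((i : ℝ) + 1) :=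
      one_div_le_one_div_of_le (Nat.cast_add_one_pos i) (by exact_mod_cast Nat.succ_le_succ hij)
    exact le_trans (show cylRadius z.2 ≤ 1 / ((j : ℝ) + 1) from hz) hle
  have hemp : s ∩ ⋂ i, T i = ∅ := by
    ext z
    simp only [mem_inter_iff, mem_iInter, mem_empty_iff_false, iff_false, not_and]
    rintro ⟨hzK, hzg⟩ hzT
    have hρ : cylRadius z.2 = 0 := by
      by_contra hne
      have hpos : 0 < cylRadius z.2 := lt_of_le_of_ne (cylRadius_nonneg _) (Ne.symm hne)
      obtain ⟨n, hn⟩ := exists_nat_one_div_lt hpos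
      exact absurd (hzT n) (not_le.2 hn)
    have h1 := hδ z hzK hρ
    have h2 : δ ≤ ‖g z‖ := hzg
    rw [Real.norm_eq_abs] at h2
    linarith
  obtain ⟨i, hi⟩ := hsc.elim_directed_family_closed T hTc hemp hdir
  refine ⟨1 / ((i : ℝ) + 1), Nat.one_div_pos_of_nat, fun z hz hzρ => ?_⟩
  by_contra hlt
  have hzs : z ∈ s := ⟨hz, by simpa [Real.norm_eq_abs] using not_lt.1 hlt⟩
  exact (eq_empty_iff_forall_notMem.1 hi z) ⟨hzs, hzρ⟩

/-! ### Thin tubes about the axis -/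

/-- **The tube `(t₁,t] × ({ϱ ≤ ε} ∩ K)`, `K ⊆ B̄(0,R)`, has measure `≤ (t-t₁)·8ε²R`**
(the tree's `volume_thinCylinder_le`). [folklore] -/
theorem prod_volume_tube_le {K : Set (EuclideanSpace ℝ (Fin 3))} {R : ℝ} (hR : 0 ≤ R)
    (hKR : K ⊆ closedBall (0 : EuclideanSpace ℝ (Fin 3)) R) {t₁ t ε : ℝ} (h1t : t₁ ≤ t) (hε : 0 ≤ ε) :
    ((volume.restrict (Ioc t₁ t)).prod (volume : Measure (EuclideanSpace ℝ (Fin 3))))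
        (univ ×ˢ ({x | cylRadius x ≤ ε} ∩ K)) ≤ ENNReal.ofReal ((t - t₁) * (8 * ε ^ 2 * R)) := by
  rw [Measure.prod_prod, Measure.restrict_apply_univ, Real.volume_Ioc, ENNReal.ofReal_mul (sub_nonneg.2 h1t)]
  refine mul_le_mul_right ((measure_mono ?_).trans (volume_thinCylinder_le hε hR)) _
  rintro x ⟨hx1, hx2⟩
  refine ⟨?_, pow_le_pow_left₀ (norm_nonneg x) (mem_closedBall_zero_iff.1 (hKR hx2)) 2⟩
  rw [← cylRadius_sq]
  exact pow_le_pow_left₀ (cylRadius_nonneg x) (show cylRadius x ≤ ε from hx1) 2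

/-! ### Calculus of the squared axis cut-off and of the product cut-off -/

/-- **The squared axis cut-off `φ_ε²`** (`φ_ε` of `Seregin2020.axisCutoff_props`): `C¹`, with
values in `[0,1]`, `= 0` for `ϱ ≤ ε/2`, `= 1` for `ε ≤ ϱ`, `‖∇φ_ε²‖ ≤ 4C_T/ε`,
`|∂_ϱφ_ε²| ≤ 4C_T/ε`, and `∇φ_ε² = 0`, `∂_ϱφ_ε² = 0` unless `ε/2 ≤ ϱ ≤ ε`.
[cite: Seregin2020, proof of Thm. 2.1 (arXiv p. 5), the cut-off φ of the axis] -/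
theorem axisCutoff_sq_props {ε : ℝ} (hε : 0 < ε) {CT : ℝ} (hCT : ∀ t, |deriv Real.smoothTransition t| ≤ CT)
    {φ : EuclideanSpace ℝ (Fin 3) → ℝ} (hφ : ∀ x, φ x = Real.smoothTransition (2 / ε * cylRadius x - 1)) :
    ContDiff ℝ 1 φ ∧ ContDiff ℝ 1 (fun y => φ y ^ 2) ∧ (∀ x, 0 ≤ φ x ∧ φ x ≤ 1) ∧
      (∀ x, cylRadius x ≤ ε / 2 → φ x = 0) ∧ (∀ x, ε ≤ cylRadius x → φ x = 1) ∧
      (∀ x, ‖gradient (fun y => φ y ^ 2) x‖ ≤ 4 * CT / ε) ∧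
      (∀ x, |fderiv ℝ (fun y => φ y ^ 2) x (eR x)| ≤ 4 * CT / ε) ∧
      (∀ x, (cylRadius x < ε / 2 ∨ ε < cylRadius x) →
        gradient (fun y => φ y ^ 2) x = 0 ∧ fderiv ℝ (fun y => φ y ^ 2) x (eR x) = 0) := by
  obtain ⟨hC, h01, h0, h1, hr0, hrle, hg, hoff⟩ := axisCutoff_props hε hCT hφ
  have hC1 : ContDiff ℝ 1 φ := hC.of_le (by norm_cast)
  have hd : ∀ x, DifferentiableAt ℝ φ x := fun x => hC1.differentiable one_ne_zero x
  have hsq : (fun y => φ y ^ 2) = fun y => φ y * φ y := funext fun y => sq (φ y)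
  have hfd2 : ∀ x, fderiv ℝ (fun y => φ y ^ 2) x = (2 * φ x) • fderiv ℝ φ x := fun x => by
    rw [hsq, fderiv_fun_mul (hd x) (hd x), ← add_smul, ← two_mul]
  have hgrad2 : ∀ x, gradient (fun y => φ y ^ 2) x = (2 * φ x) • gradient φ x := fun x => by
    simp only [gradient, hfd2 x, map_smul]
  refine ⟨hC1, by rw [hsq]; exact hC1.mul hC1, h01, h0, h1, fun x => ?_, fun x => ?_, fun x hx => ?_⟩
  · rw [hgrad2 x, norm_smul, Real.norm_eq_abs, abs_of_nonneg (by nlinarith [(h01 x).1] : (0:ℝ) ≤ 2 * φ x)]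
    calc 2 * φ x * ‖gradient φ x‖ ≤ 2 * 1 * (2 * CT / ε) :=
          mul_le_mul (by nlinarith [(h01 x).2]) (hg x) (norm_nonneg _) (by norm_num)
      _ = 4 * CT / ε := by ring
  · rw [hfd2 x, FunLike.coe_smul, Pi.smul_apply, smul_eq_mul, abs_mul,
      abs_of_nonneg (by nlinarith [(h01 x).1] : (0:ℝ) ≤ 2 * φ x), abs_of_nonneg (hr0 x)]
    calc 2 * φ x * fderiv ℝ φ x (eR x) ≤ 2 * 1 * (2 * CT / ε) :=
          mul_le_mul (by nlinarith [(h01 x).2]) (hrle x) (hr0 x) (by norm_num)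
      _ = 4 * CT / ε := by ring
  · have hz : fderiv ℝ φ x = 0 := hoff x hx
    refine ⟨?_, ?_⟩
    · rw [hgrad2 x, gradient, hz, map_zero, smul_zero]
    · rw [hfd2 x, hz, smul_zero]
      rfl

/-- `∇(Θφ)² = φ²∇Θ² + Θ²∇φ²` for `C¹` functions `Θ`, `φ`. [folklore] -/
theorem gradient_cutoffProduct_sq {Θ φ : EuclideanSpace ℝ (Fin 3) → ℝ} (hΘ : ContDiff ℝ 1 Θ)
    (hφ : ContDiff ℝ 1 φ) (x : EuclideanSpace ℝ (Fin 3)) :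
    gradient (fun y => (Θ y * φ y) ^ 2) x =
      φ x ^ 2 • gradient (fun y => Θ y ^ 2) x + Θ x ^ 2 • gradient (fun y => φ y ^ 2) x := by
  have h : (fun y => (Θ y * φ y) ^ 2) = fun y => Θ y ^ 2 * φ y ^ 2 := funext fun y => mul_pow _ _ _
  have hdΘ : DifferentiableAt ℝ (fun y => Θ y ^ 2) x := (hΘ.differentiable one_ne_zero x).pow 2
  have hdφ : DifferentiableAt ℝ (fun y => φ y ^ 2) x := (hφ.differentiable one_ne_zero x).pow 2
  rw [h, gradient_mul_apply' hdΘ hdφ, add_comm]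

/-- `D(Θφ)²·v = φ² DΘ²·v + Θ² Dφ²·v` for `C¹` functions `Θ`, `φ`. [folklore] -/
theorem fderiv_cutoffProduct_sq_apply {Θ φ : EuclideanSpace ℝ (Fin 3) → ℝ} (hΘ : ContDiff ℝ 1 Θ)
    (hφ : ContDiff ℝ 1 φ) (x v : EuclideanSpace ℝ (Fin 3)) :
    fderiv ℝ (fun y => (Θ y * φ y) ^ 2) x v =
      φ x ^ 2 * fderiv ℝ (fun y => Θ y ^ 2) x v + Θ x ^ 2 * fderiv ℝ (fun y => φ y ^ 2) x v := by
  have h : (fun y => (Θ y * φ y) ^ 2) = fun y => Θ y ^ 2 * φ y ^ 2 := funext fun y => mul_pow _ _ _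
  have hdΘ : DifferentiableAt ℝ (fun y => Θ y ^ 2) x := (hΘ.differentiable one_ne_zero x).pow 2
  have hdφ : DifferentiableAt ℝ (fun y => φ y ^ 2) x := (hφ.differentiable one_ne_zero x).pow 2
  rw [h, fderiv_fun_mul hdΘ hdφ]
  simp only [_root_.add_apply, FunLike.coe_smul, Pi.smul_apply, smul_eq_mul]
  ring

/-- The product cut-off `Θφ_ε` is supported in `tsupport Θ ∩ {ε/2 ≤ ϱ}`. [folklore] -/
theorem tsupport_cutoffProduct_subset {Θ φ : EuclideanSpace ℝ (Fin 3) → ℝ} {ε : ℝ}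
    (h0 : ∀ x, cylRadius x ≤ ε / 2 → φ x = 0) :
    tsupport (fun y => Θ y * φ y) ⊆ tsupport Θ ∩ {x | ε / 2 ≤ cylRadius x} := by
  refine subset_inter tsupport_mul_subset_left (tsupport_mul_subset_right.trans ?_)
  refine closure_minimal (fun x hx => ?_) (isClosed_le continuous_const continuous_cylRadius)
  by_contra h
  simp only [mem_setOf_eq, not_le] at h
  exact hx (h0 x h.le)

end Summit.NavierStokesRegularity.NavierStokesRegularity.Theorems.AxisymmetricKatoGlobal.EulerScaling

end
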